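import Literature.NumberTheory.EllipticCurves.Kobayashi2003.SignedSelmerDualExistsProofs
import Literature.NumberTheory.EllipticCurves.IwasawaSelmerDualUniquenessProofs
import HarnessLib

/-!
# The signed Iwasawa module `X^±(E/K_∞)` is UNIQUE up to `Λ`-isomorphism: any two
# `SignedSelmerDualData W κ γ ε` have `Λ`-isomorphic modules

Topic `Literature/NumberTheory/EllipticCurves`, cluster `Kobayashi2003`; sibling of
`SignedSelmer.lean` (p207367) and `SignedSelmerDualExistsProofs.lean` (p207616). HONEST FRAMING
(cell `b2b-bsdres`, harvest seat 2 gen 11): this file shows that the hypothesis structure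
`SignedSelmerDualData W κ γ ε` pins down ONE `Λ`-module up to isomorphism — so that a statement
"`∀ D : SignedSelmerDualData W κ γ ε, P(D.X)`" with `P` isomorphism-invariant (finite generation,
torsion, characteristic ideal, `μ`, `λ`) says exactly "`P` holds for THE Pontryagin dual of
`Sel^ε(E/K_∞)` with its natural `ℤ_p[[Γ]]`-action" (Kobayashi, Invent. Math. 152 (2003), p. 2:
"`ℤ_p[[Γ]]` acts naturally on the Pontryagin dual of `Sel^±(E/F_∞)`"), neither more nor less. It
is the signed copy, word for word, of the tree's `WeierstrassCurve.SelmerDualData.exists_linearEquiv`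
/ `nonempty_linearEquiv_holds` (`IwasawaSelmerDualUniquenessProofs.lean`): the two structure
identities (`T` acts as `x ↦ x ∘ (conj_γ - 1)`, constants through `ℤ_p → ℤ/pᵏ`) FORCE the
`Λ`-action, because every class of `Sel^ε(E/K_∞) ≤ H¹(K_∞, E[p^∞])` is killed by a power of `p`
and by a power of `conj_γ - 1` (for ANY `γ ∈ Γ_K`: `exists_conjH1_pow_prime_pow_eq'`, a statement
about all of `H¹(K_∞, E[p^∞])`). No definition, no named fact; nothing else asserted.

References: S. Kobayashi, Invent. Math. 152 (2003), Def. 1.1 and the sentence following it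
[Kobayashi2003]; R. Greenberg, LNM 1716 (1999), §1 (PDF p. 60) [GreenbergLNM1716]; L. Washington,
*Introduction to Cyclotomic Fields*, §13.2 [Washington1997].
-/

open Literature.NumberTheory.EllipticCurves

universe u

noncomputable section

namespace Literature.NumberTheory.EllipticCurves.Kobayashi2003

open ZpExtension

variable {K : Type u} [Field K] [NumberField K] (W : WeierstrassCurve K) {p : ℕ} [Fact p.Prime]
  (κ : ZpExtension K p) (ε : ℤˣ)

/-- `conj_γ - 1` is locally nilpotent on the `p`-primary group `Sel^ε(E/K_∞)` for an ARBITRARY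
`γ ∈ Γ_K` (version of `isLocNil_conjSignedSelmerInfty_sub_one` without `κ γ = 1`): (P)
`exists_pow_smul_subgroupH1_ker_eq_zero` and `exists_conjH1_pow_prime_pow_eq'`
(`IwasawaSelmerDualUniquenessProofs`), both about all of `H¹(K_∞, E[p^∞])`.
[cite: Kobayashi2003, Def. 1.1 (sentence following it, p. 2)] -/
theorem isLocNil_conjSignedSelmerInfty_sub_one' (γ : Field.absoluteGaloisGroup K) :
    IwasawaDual.IsLocNil p (conjSignedSelmerInfty W κ ε γ - 1) := by
  have htor : ∀ s : signedSelmerInfty W κ ε, ∃ k : ℕ, p ^ k • s = 0 := fun s ↦ by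
    obtain ⟨k, hk⟩ := W.exists_pow_smul_subgroupH1_ker_eq_zero κ (s : W.subgroupH1 p κ.kerSubgroup)
    exact ⟨k, Subtype.ext (by rw [AddSubgroupClass.coe_nsmul]; exact hk)⟩
  refine ⟨htor, fun s ↦ ?_⟩
  obtain ⟨a, ha⟩ := W.exists_conjH1_pow_prime_pow_eq' κ γ (s : W.subgroupH1 p κ.kerSubgroup)
  obtain ⟨k, hk⟩ := htor s
  have hφ : ((conjSignedSelmerInfty W κ ε γ) ^ p ^ a) s = s :=
    Subtype.ext (by rw [coe_conjSignedSelmerInfty_pow_apply]; exact ha)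
  exact ⟨k * p ^ a, IwasawaDual.pow_mul_prime_pow_apply_eq_zero (Fact.out : p.Prime) _ a hφ hk⟩

namespace SignedSelmerDualData

variable {W κ ε} {γ : Field.absoluteGaloisGroup K} (D : SignedSelmerDualData W κ γ ε)

/-- Induction step carrier for `toDual_smul`: on classes `s ∈ Sel^ε_∞` killed by `ψ^N`,
`ψ = conj_γ - 1`, the action of any `SignedSelmerDualData` read through `toDual` is the canonical
finite sum `IsLocNil.smulFun` (induction on `N`, peeling off the constant term
`f = T · g + C(a₀)`). Signed copy of `SelmerDualData.toDual_smul_apply_of_pow_apply_eq_zero`.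
[cite: Kobayashi2003, Def. 1.1 (sentence following it, p. 2)] -/
theorem toDual_smul_apply_of_pow_apply_eq_zero (N : ℕ) :
    ∀ (s : signedSelmerInfty W κ ε), ((conjSignedSelmerInfty W κ ε γ - 1) ^ N) s = 0 →
      ∀ (f : IwasawaAlgebra p) (x : D.X),
        D.toDual (f • x) s =
          (isLocNil_conjSignedSelmerInfty_sub_one' W κ ε γ).smulFun f (D.toDual x) s := by
  set h := isLocNil_conjSignedSelmerInfty_sub_one' W κ ε γ
  set ψ : AddMonoid.End (signedSelmerInfty W κ ε) := conjSignedSelmerInfty W κ ε γ - 1 with hψ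
  induction N with
  | zero =>
    intro s hs f x
    rw [pow_zero, AddMonoid.End.one_apply] at hs
    rw [hs, map_zero, map_zero]
  | succ N ih =>
    intro s hs f x
    obtain ⟨k, hk⟩ := h.torsion s
    have hψs : (ψ ^ N) (ψ s) = 0 := by
      rwa [pow_succ, AddMonoid.End.coe_mul, Function.comp_apply] at hs
    have hψeval : ∀ y : D.X, D.toDual y (ψ s) =
        D.toDual y ⟨W.conjH1 p κ.kerSubgroup γ s, D.conj_mem s s.2⟩ - D.toDual y s := fun y ↦ by
      rw [hψ, IwasawaDual.End_sub_apply, AddMonoid.End.one_apply, map_sub]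
      rfl
    set g : IwasawaAlgebra p := PowerSeries.mk fun n ↦ PowerSeries.coeff (n + 1) f
    set a : ℤ_[p] := PowerSeries.constantCoeff f
    have hf : f = PowerSeries.X * g + PowerSeries.C a := PowerSeries.eq_X_mul_shift_add_const f
    have lhs : D.toDual (f • x) s =
        D.toDual (g • x) (ψ s) + (PadicInt.toZModPow k a).val • D.toDual x s := by
      conv_lhs => rw [hf]
      rw [add_smul, mul_smul, map_add, AddMonoidHom.add_apply, D.toDual_T_smul,
        D.toDual_C_smul a x s k hk, hψeval]
    have rhs : h.smulFun f (D.toDual x) s =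
        h.smulFun g (D.toDual x) (ψ s) + (PadicInt.toZModPow k a).val • D.toDual x s := by
      conv_lhs => rw [hf]
      rw [h.smulFun_add_left, h.smulFun_mul_left, AddMonoidHom.add_apply, h.smulFun_X_apply,
        h.smulFun_C_apply a (D.toDual x) hk]
    rw [lhs, rhs, ih (ψ s) hψs g x]

/-- **The `Λ`-action of a `SignedSelmerDualData` is forced**: for any datum `D` and all `f ∈ Λ`,
`x ∈ X`, `toDual (f • x) = f ⋆ toDual x` with `⋆` the canonical action `IsLocNil.smulFun` attached to
`ψ = conj_γ - 1` on `Hom(Sel^ε_∞, ℚ/ℤ)`. Signed copy of `SelmerDualData.toDual_smul`.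
[cite: Kobayashi2003, Def. 1.1 (sentence following it, p. 2)] -/
theorem toDual_smul (f : IwasawaAlgebra p) (x : D.X) :
    D.toDual (f • x) = (isLocNil_conjSignedSelmerInfty_sub_one' W κ ε γ).smulFun f (D.toDual x) := by
  ext s
  obtain ⟨N, hN⟩ := (isLocNil_conjSignedSelmerInfty_sub_one' W κ ε γ).nil s
  exact D.toDual_smul_apply_of_pow_apply_eq_zero N s hN f x

/-- **The comparison isomorphism** `toDual'⁻¹ ∘ toDual : D.X ≃ₗ[Λ] D'.X` between two signed
Pontryagin-dual data for the same `(W, κ, γ, ε)` exists and commutes with the identifications with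
`Hom(Sel^ε_∞, ℚ/ℤ)` (group isomorphism; `Λ`-linear by `toDual_smul`). Signed copy of
`SelmerDualData.exists_linearEquiv`. [cite: Kobayashi2003, Def. 1.1 (sentence following it, p. 2)] -/
theorem exists_linearEquiv (D D' : SignedSelmerDualData W κ γ ε) :
    ∃ e : D.X ≃ₗ[IwasawaAlgebra p] D'.X, ∀ x, D'.toDual (e x) = D.toDual x := by
  refine ⟨{ toFun := fun x ↦ (AddEquiv.ofBijective D'.toDual D'.bijective).symm (D.toDual x)
            invFun := fun x' ↦ (AddEquiv.ofBijective D.toDual D.bijective).symm (D'.toDual x')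
            map_add' := fun x y ↦ by rw [map_add, map_add]
            map_smul' := fun f x ↦ ?_
            left_inv := fun x ↦ ?_
            right_inv := fun x' ↦ ?_ }, fun x ↦ ?_⟩
  · apply D'.bijective.injective
    have e1 : D'.toDual ((AddEquiv.ofBijective D'.toDual D'.bijective).symm (D.toDual (f • x))) =
        D.toDual (f • x) :=
      (AddEquiv.ofBijective D'.toDual D'.bijective).apply_symm_apply _
    have e2 : D'.toDual ((AddEquiv.ofBijective D'.toDual D'.bijective).symm (D.toDual x)) =
        D.toDual x :=
      (AddEquiv.ofBijective D'.toDual D'.bijective).apply_symm_apply _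
    rw [RingHom.id_apply, e1, D'.toDual_smul, e2, D.toDual_smul]
  · apply D.bijective.injective
    have e1 : D.toDual ((AddEquiv.ofBijective D.toDual D.bijective).symm
        (D'.toDual ((AddEquiv.ofBijective D'.toDual D'.bijective).symm (D.toDual x)))) =
        D'.toDual ((AddEquiv.ofBijective D'.toDual D'.bijective).symm (D.toDual x)) :=
      (AddEquiv.ofBijective D.toDual D.bijective).apply_symm_apply _
    have e2 : D'.toDual ((AddEquiv.ofBijective D'.toDual D'.bijective).symm (D.toDual x)) =
        D.toDual x :=
      (AddEquiv.ofBijective D'.toDual D'.bijective).apply_symm_apply _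
    exact e1.trans e2
  · apply D'.bijective.injective
    have e1 : D'.toDual ((AddEquiv.ofBijective D'.toDual D'.bijective).symm
        (D.toDual ((AddEquiv.ofBijective D.toDual D.bijective).symm (D'.toDual x')))) =
        D.toDual ((AddEquiv.ofBijective D.toDual D.bijective).symm (D'.toDual x')) :=
      (AddEquiv.ofBijective D'.toDual D'.bijective).apply_symm_apply _
    have e2 : D.toDual ((AddEquiv.ofBijective D.toDual D.bijective).symm (D'.toDual x')) =
        D'.toDual x' :=
      (AddEquiv.ofBijective D.toDual D.bijective).apply_symm_apply _
    exact e1.trans e2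
  · exact (AddEquiv.ofBijective D'.toDual D'.bijective).apply_symm_apply _

/-- **Uniqueness of the signed Iwasawa module up to `Λ`-isomorphism**: any two
`SignedSelmerDualData W κ γ ε` have `Λ`-isomorphic underlying modules; in particular every datum is
`Λ`-isomorphic to the canonical one `signedSelmerDualData W κ ε hγ` (`SignedSelmerDualExistsProofs`).
[cite: Kobayashi2003, Def. 1.1 (sentence following it, p. 2)] -/
theorem nonempty_linearEquiv (D D' : SignedSelmerDualData W κ γ ε) :
    Nonempty (D.X ≃ₗ[IwasawaAlgebra p] D'.X) :=
  (exists_linearEquiv D D').nonempty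

/-- Consequence used by fact statements quantified over all data: `Module.Finite` transports along
the comparison isomorphism, so finite generation of ONE datum's module is finite generation of
every datum's module. [cite: Kobayashi2003, Def. 1.1 (sentence following it, p. 2)] -/
theorem moduleFinite_iff (D D' : SignedSelmerDualData W κ γ ε) :
    Module.Finite (IwasawaAlgebra p) D.X ↔ Module.Finite (IwasawaAlgebra p) D'.X := by
  obtain ⟨e, -⟩ := exists_linearEquiv D D'
  exact ⟨fun _ ↦ Module.Finite.equiv e, fun _ ↦ Module.Finite.equiv e.symm⟩

/-- Likewise `Module.IsTorsion` transports along the comparison isomorphism.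
[cite: Kobayashi2003, Def. 1.1 (sentence following it, p. 2)] -/
theorem isTorsion_iff (D D' : SignedSelmerDualData W κ γ ε) :
    Module.IsTorsion (IwasawaAlgebra p) D.X ↔ Module.IsTorsion (IwasawaAlgebra p) D'.X := by
  obtain ⟨e, -⟩ := exists_linearEquiv D D'
  constructor
  · intro h x
    obtain ⟨r, hr⟩ := @h (e.symm x)
    refine ⟨r, ?_⟩
    rw [Submonoid.smul_def] at hr ⊢
    have := congrArg e hr
    rwa [map_smul, map_zero, LinearEquiv.apply_symm_apply] at this
  · intro h x
    obtain ⟨r, hr⟩ := @h (e x)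
    refine ⟨r, ?_⟩
    rw [Submonoid.smul_def] at hr ⊢
    have := congrArg e.symm hr
    rwa [map_smul, map_zero, LinearEquiv.symm_apply_apply] at this

end SignedSelmerDualData

end Literature.NumberTheory.EllipticCurves.Kobayashi2003

end
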